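import Summits.CriticalPhenomena.PercolationContinuityZ3.Theorems.Transplant.SkelFrmBChoiceCreepY3
import HarnessLib

/-!
# N2 (frames-only node `SamePDropOfSkeletonFrm₁`, OPEN) — (ζ″) at the (R-45) instance of record `BSlot.small3 = (76·s₀, 19·s₁)`: THE y′-CORRIDOR's ARRIVAL READING ROW ALONG (`hLl` at `du.1 = 1`, axis 1) at the
# tuple of record, `NegB.hLlY_W` — p5-g16's `HY` conjunct `20r₁ − b₁ + 1 ≤ rdLo₁ ∧ 5r₁ ≤ rdLo₁ ∧ rdHi₁ ≤ 20r₁ + b₁ − 1 ∧ rdHi₁ ≤ 22r₁` on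
# `[kgLastLoY N, kgLastHiY N] = [arrLoY3, arrHiY3]` (SkelFrmBChoiceCreepY3 `arrY3_eq`, `rfl`)

The y′-run length of record `N := kgNYv0` is the CENTRING choice `kgNY … (kgTgtY0 …)` (SkelFrmBParamsCorrKG0): by `KGYRows.kgNY_spec` the arrival's far row
`FarY N = (N+1)·sL + XY N` lies in `(tgt − sL − ΔY, tgt]`, `tgt = kgTgtY0 = pitchY + ⌊P₀/2⌋ + ⌊(sL + ΔY)/2⌋`, `ΔY = 3R′ + 2`, `pitchY = ⌊20K·Δ/U⌋`
(SkelFrmBParamsCorrKGY), provided ONE HOP FITS (`farY_zero_le_tgtY0_W`: `sL + XY 0 ≤ 23·sL ≤ tgt`, from `XY_le_3 … 0`).  The box's rows are `[FarY − P₀, FarY]`,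
and the fine-1 reading is `⌊s₁·U·row/Δ⌋` (`rd1_div_eq`, `c₁′·A·40KqΔ = r₁·D`), so the box reads inside `20K·s₁ ± (s₁ + ε)` — well inside the window
`20r₁ ± (b₁ − 1)`, `r₁ = K·s₁`, `b₁ = BSlot.small3 1 = 19·s₁` (margin ≈ 18·s₁ each side).
* `arrivalY_coreW` (pure ℤ), `pitchY_floor_W`, `tgtY0_two_mul_W`, `farY_zero_le_tgtY0_W`, `farY_spec_W` (the centring at the tuple), **`hLlY_W`**.
NON-VACUITY: value rows at the closed tuple (binder set = `hLl_Q`'s + `hKq`, the latter only through `XY_le_3`).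
builds on p205010 (kernel theorem, internal audit signed; external expert review pending) — nothing in this file uses p205010; NOTHING is claimed about the open node `SamePDropOfSkeletonFrm₁`.
Lane `prim-bschramm`, seat `prim-bschramm-stmt` (gen 21); helper file (`--supports stmt-CriticalPhenomena-4575 --as helper`).
[cite: KozmaNitzan2024, §4 Lemma 12 (pp. 23–25: the target box), p. 25 (the renormalised lattice)] [cite: MartineauTassion2017, §4.3 Lemma 4.2 (steering)]
-/

open scoped Classical

noncomputable section

namespace Summit.CriticalPhenomena.PercolationContinuityZ3.Theorems.Transplant

namespace PlanarSkeletonFrm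

namespace NegB

open Literature.Probability.Percolation Literature.Probability.LatticeModels SimpleGraph
open SkelConc (Consts)
open Skelφ (shearUnit kgSL kgSLY kgXY kgFarY kgNY kgΔY rdLo rdHi KGYRows)
open TwoAxis.Para (modulus)
open Neg

/-! ## §1 The pure-integer core -/

/-- **The pure-integer core of the y′-arrival along row**: the steering target `tgt = pitchY + ⌊P₀/2⌋ + ⌊(sL + 3R′ + 2)/2⌋` with
`U·pitchY ∈ (20KΔ − U, 20KΔ]`, the centring `FarY ∈ (tgt − sL − (3R′+2), tgt]` (`kgNY_spec`), the box rows `[FarY − P₀, FarY]` and the fine-1 floors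
`Flo = ⌊s₁·U·lo₁/Δ⌋`, `Fhi = ⌊s₁·(U·hi₁ + U − 1)/Δ⌋` give `20K·s₁ − 19s₁ + 1 ≤ Flo`, `5K·s₁ ≤ Flo`, `Fhi + 1 ≤ 20K·s₁ + 19s₁ − 1`, `Fhi + 1 ≤ 22K·s₁`
(margins `≈ 18·s₁`, using `40K·R′ ≤ sL + 1`, `958·U ≤ U·sL ≤ Δ`). [folklore] -/
theorem arrivalY_coreW {U Δ s K R P₀ pY tgt hi₁ lo₁ s₁ Flo Fhi : ℤ}
    (hU : 1 ≤ U) (hUs : U * s ≤ Δ) (hs : 958 ≤ s) (hK : 40 ≤ K) (hR : 1 ≤ R) (hKR : 40 * K * R ≤ s + 1)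
    (hP1 : P₀ ≤ s + 1)
    (hpy1 : U * pY ≤ 20 * K * Δ) (hpy2 : 20 * K * Δ < U * pY + U)
    (ht1 : 2 * pY + P₀ + s + 3 * R ≤ 2 * tgt) (ht2 : 2 * tgt ≤ 2 * pY + P₀ + s + 3 * R + 2)
    (hfar : hi₁ ≤ tgt) (htgt : tgt < hi₁ + s + (3 * R + 2)) (hlo : lo₁ = hi₁ - P₀)
    (hs1 : 1 ≤ s₁) (hFlo' : s₁ * (U * lo₁) < Δ * Flo + Δ) (hFhi : Δ * Fhi ≤ s₁ * (U * hi₁ + U - 1)) :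
    20 * (K * s₁) - 19 * s₁ + 1 ≤ Flo ∧ 5 * (K * s₁) ≤ Flo ∧ Fhi + 1 ≤ 20 * (K * s₁) + 19 * s₁ - 1 ∧ Fhi + 1 ≤ 22 * (K * s₁) := by
  have hU0 : 0 < U := by linarith
  have hU958 : 958 * U ≤ Δ := by have := mul_le_mul_of_nonneg_left hs hU0.le; linarith
  have hΔ0 : 0 < Δ := by linarith
  have hs1p : 0 < s₁ := by linarith
  have hUR0 : 0 ≤ U * R := by positivity
  have hUR : 40 * K * (U * R) ≤ Δ + U := by
    have := mul_le_mul_of_nonneg_left hKR hU0.le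
    calc 40 * K * (U * R) = U * (40 * K * R) := by ring
      _ ≤ U * (s + 1) := this
      _ = U * s + U := by ring
      _ ≤ Δ + U := by linarith
  have h1600 : 1600 * (U * R) ≤ 40 * K * (U * R) := mul_le_mul_of_nonneg_right (by linarith) hUR0
  have hKs1 : 40 * s₁ ≤ K * s₁ := mul_le_mul_of_nonneg_right hK hs1p.le
  -- lower chain
  have h2lo : 2 * pY - 2 * s - 3 * R - 5 ≤ 2 * lo₁ := by rw [hlo]; linarith
  have h2Ulo : 40 * K * Δ - 2 * Δ - 3 * (U * R) - 7 * U ≤ 2 * (U * lo₁) := by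
    have a := mul_le_mul_of_nonneg_left h2lo hU0.le
    have e1 : U * (2 * pY - 2 * s - 3 * R - 5) = 2 * (U * pY) - 2 * (U * s) - 3 * (U * R) - 5 * U := by ring
    have e2 : U * (2 * lo₁) = 2 * (U * lo₁) := by ring
    linarith
  have hb := mul_le_mul_of_nonneg_left h2Ulo hs1p.le
  have hX : 2 * Δ ≤ 36 * Δ - 3 * (U * R) - 7 * U := by linarith
  have hX1 : 1 * (36 * Δ - 3 * (U * R) - 7 * U) ≤ s₁ * (36 * Δ - 3 * (U * R) - 7 * U) := mul_le_mul_of_nonneg_right hs1 (by linarith)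
  have klo : Δ * (20 * (K * s₁) - 19 * s₁) < Δ * Flo := by
    have e3 : s₁ * (40 * K * Δ - 2 * Δ - 3 * (U * R) - 7 * U) = 40 * (Δ * (K * s₁)) - 2 * (Δ * s₁) - 3 * (s₁ * (U * R)) - 7 * (s₁ * U) := by ring
    have e4 : s₁ * (2 * (U * lo₁)) = 2 * (s₁ * (U * lo₁)) := by ring
    have e5 : s₁ * (36 * Δ - 3 * (U * R) - 7 * U) = 36 * (Δ * s₁) - 3 * (s₁ * (U * R)) - 7 * (s₁ * U) := by ring
    have e6 : Δ * (20 * (K * s₁) - 19 * s₁) = 20 * (Δ * (K * s₁)) - 19 * (Δ * s₁) := by ring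
    linarith
  have hlo1 := lt_of_mul_lt_mul_left klo hΔ0.le
  -- upper chain
  have h2hi : 2 * hi₁ ≤ 2 * pY + 2 * s + 3 * R + 3 := by linarith
  have h2Uhi : 2 * (U * hi₁) + 2 * U - 2 ≤ 40 * K * Δ + 2 * Δ + 3 * (U * R) + 5 * U - 2 := by
    have a := mul_le_mul_of_nonneg_left h2hi hU0.le
    have e1 : U * (2 * pY + 2 * s + 3 * R + 3) = 2 * (U * pY) + 2 * (U * s) + 3 * (U * R) + 3 * U := by ring
    have e2 : U * (2 * hi₁) = 2 * (U * hi₁) := by ring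
    linarith
  have hc := mul_le_mul_of_nonneg_left h2Uhi hs1p.le
  have khi : Δ * Fhi < Δ * (20 * (K * s₁) + 19 * s₁ - 1) := by
    have e3 : s₁ * (40 * K * Δ + 2 * Δ + 3 * (U * R) + 5 * U - 2) = 40 * (Δ * (K * s₁)) + 2 * (Δ * s₁) + 3 * (s₁ * (U * R)) + 5 * (s₁ * U) - 2 * s₁ := by ring
    have e4 : s₁ * (2 * (U * hi₁) + 2 * U - 2) = 2 * (s₁ * (U * hi₁ + U - 1)) := by ring
    have e5 : s₁ * (36 * Δ - 3 * (U * R) - 7 * U) = 36 * (Δ * s₁) - 3 * (s₁ * (U * R)) - 7 * (s₁ * U) := by ring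
    have e6 : Δ * (20 * (K * s₁) + 19 * s₁ - 1) = 20 * (Δ * (K * s₁)) + 19 * (Δ * s₁) - Δ := by ring
    have hsU : 0 ≤ s₁ * U := by positivity
    linarith
  have hhi1 := lt_of_mul_lt_mul_left khi hΔ0.le
  refine ⟨by linarith, by linarith, by linarith, by linarith⟩

/-! ## §2 The centring at the tuple of record and the row -/

section ArrivalY

variable (κ : Consts) {V : Type} [DecidableEq V] [Countable V] {G : SimpleGraph V} [G.LocallyFinite] (Φ : PlanarSkeletonFrm G) (t : V) (p : unitInterval)
  (D : Skelφ.StepI.DataNS V) (g f mk : ℕ)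

/- The tuple's atoms as hygiene-free local notations (they expand syntactically at each use; importers see the expanded terms). -/
set_option hygiene false in local notation "NYᵣ" => kgNYv0 κ Φ t p D g f mk (qxYQ4 κ Φ t p D g f) (WxYQ4 κ Φ t p D g f)
set_option hygiene false in local notation "qYᵣ" => kgqY κ Φ t p D g f (qxYQ4 κ Φ t p D g f)
set_option hygiene false in local notation "WYᵣ" => kgWY κ Φ t p D g f (WxYQ4 κ Φ t p D g f)
set_option hygiene false in local notation "Rᵣ" => kgR κ Φ t p D mk
set_option hygiene false in local notation "nᵣ" => nL κ Φ t p D g f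
set_option hygiene false in local notation "ℓᵣ" => ℓL κ Φ t p D g f
set_option hygiene false in local notation "hᵣ" => hL κ Φ t p D g f
set_option hygiene false in local notation "vᵣ" => vL κ Φ t p D g f
set_option hygiene false in local notation "Uᵣ" => shearUnit (nL κ Φ t p D g f) (hL κ Φ t p D g f)
set_option hygiene false in local notation "Δᵣ" => modulus (nL κ Φ t p D g f) (hL κ Φ t p D g f) (vL κ Φ t p D g f) (vβL κ Φ t p D g f)
set_option hygiene false in local notation "sLᵣ" => kgSL (nL κ Φ t p D g f) (ℓL κ Φ t p D g f) (hL κ Φ t p D g f)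
set_option hygiene false in local notation "s1ᵣ" => (((fcellsA κ Φ t p D g f).s 1 : ℕ) : ℤ)
set_option hygiene false in local notation "r1ᵣ" => (((fcellsA κ Φ t p D g f).r 1 : ℕ) : ℤ)
set_option hygiene false in local notation "Kᵣ" => ((Neg.K κ : ℕ) : ℤ)
set_option hygiene false in local notation "LO1ᵣ" => rdLo (Aof κ) (nL κ Φ t p D g f) (hL κ Φ t p D g f) (vL κ Φ t p D g f) (vβL κ Φ t p D g f) (prFA κ Φ t p D g f).c₀ (prFA κ Φ t p D g f).c₁ (prFA κ Φ t p D g f).D (arrLoY3 κ Φ t p D g f mk) (arrHiY3 κ Φ t p D g f mk) 1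
set_option hygiene false in local notation "HI1ᵣ" => rdHi (Aof κ) (nL κ Φ t p D g f) (hL κ Φ t p D g f) (vL κ Φ t p D g f) (vβL κ Φ t p D g f) (prFA κ Φ t p D g f).c₀ (prFA κ Φ t p D g f).c₁ (prFA κ Φ t p D g f).D (arrLoY3 κ Φ t p D g f mk) (arrHiY3 κ Φ t p D g f mk) 1

/-- `U·pitchY ≤ 20K·Δ < U·pitchY + U` (`pitchY = ⌊20KΔ/U⌋`). [folklore] -/
theorem pitchY_floor_W (hN : EqNumL κ Φ t p D g f) :
    ((Uᵣ : ℕ) : ℤ) * pitchY κ Φ t p D g f ≤ 20 * Kᵣ * Δᵣ ∧ 20 * Kᵣ * Δᵣ < ((Uᵣ : ℕ) : ℤ) * pitchY κ Φ t p D g f + ((Uᵣ : ℕ) : ℤ) := by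
  obtain ⟨hn1, -⟩ := one_le_of_eqNumL κ Φ t p D g f hN
  have hU : (0 : ℤ) < (Uᵣ : ℕ) := Skelφ.shearUnit_pos hn1 _
  have epy : pitchY κ Φ t p D g f = 20 * Kᵣ * Δᵣ / (Uᵣ : ℕ) := rfl
  rw [epy]
  exact ⟨Int.mul_ediv_self_le (ne_of_gt hU), Int.lt_mul_ediv_self_add hU⟩

/-- `2·tgtY0 ∈ [2·pitchY + P₀ + sL + 3R′, 2·pitchY + P₀ + sL + 3R′ + 2]` (`P₀ = ⌊nℓ/U⌋`). [folklore] -/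
theorem tgtY0_two_mul_W :
    2 * pitchY κ Φ t p D g f + ((nᵣ * ℓᵣ / Uᵣ : ℕ) : ℤ) + sLᵣ + 3 * ((Rᵣ : ℕ) : ℤ) ≤ 2 * kgTgtY0 κ Φ t p D g f mk ∧
      2 * kgTgtY0 κ Φ t p D g f mk ≤ 2 * pitchY κ Φ t p D g f + ((nᵣ * ℓᵣ / Uᵣ : ℕ) : ℤ) + sLᵣ + 3 * ((Rᵣ : ℕ) : ℤ) + 2 := by
  have eT : kgTgtY0 κ Φ t p D g f mk = pitchY κ Φ t p D g f + ((((nᵣ * ℓᵣ / Uᵣ + 1 : ℕ) : ℤ) - 1) / 2) + (kgSLY nᵣ ℓᵣ hᵣ + kgΔY Rᵣ 0) / 2 := rfl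
  have eΔ : kgΔY Rᵣ 0 = 3 * ((Rᵣ : ℕ) : ℤ) + 2 * ((0 : ℕ) : ℤ) + 2 := rfl
  have b1 := two_mul_ediv_two ((((nᵣ * ℓᵣ / Uᵣ + 1 : ℕ) : ℤ)) - 1)
  have b2 := two_mul_ediv_two (kgSLY nᵣ ℓᵣ hᵣ + kgΔY Rᵣ 0)
  rw [eT]
  rw [eΔ, kgSLY_eq_kgSL] at b2 ⊢
  push_cast at b1 b2 ⊢
  constructor <;> linarith

/-- **ONE HOP FITS**: `FarY 0 = sL + XY 0 ≤ tgtY0` (`XY 0 ≤ 22·sL`, `pitchY ≥ 20K·sL − 1`). [this work] -/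
theorem farY_zero_le_tgtY0_W (hKq : 5 ≤ Neg.Kq κ) (hN : EqNumL κ Φ t p D g f) (hg : gFloorKG κ Φ t p D mk ≤ g) (hg2 : 40 * Neg.K κ * KS0.R'0 κ Φ t p D mk ≤ g) :
    kgFarY nᵣ ℓᵣ hᵣ vᵣ Rᵣ 0 qYᵣ WYᵣ 0 ≤ kgTgtY0 κ Φ t p D g f mk := by
  obtain ⟨hn1, -⟩ := one_le_of_eqNumL κ Φ t p D g f hN
  obtain ⟨-, -, hbig, hR1, hK40, -⟩ := valsQ_floor κ Φ t p D g f mk hN hg hg2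
  have hUs := UsL_le_modulus κ Φ t p D g f hN
  obtain ⟨-, hpy2⟩ := pitchY_floor_W κ Φ t p D g f hN
  obtain ⟨ht1, -⟩ := tgtY0_two_mul_W κ Φ t p D g f mk
  have hK0 : (0 : ℤ) ≤ 20 * Kᵣ := by positivity
  have hXY := (XY_le_3 κ Φ t p D g f mk hKq hN hg hg2 0 (by push_cast; linarith)).2
  have hU : (0 : ℤ) < (Uᵣ : ℕ) := Skelφ.shearUnit_pos hn1 _
  have hP0 : (0 : ℤ) ≤ ((nᵣ * ℓᵣ / Uᵣ : ℕ) : ℤ) := by positivity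
  have hR0 : (0 : ℤ) ≤ ((KS0.R'0 κ Φ t p D mk : ℕ) : ℤ) := by positivity
  have hRR : ((KS0.R'0 κ Φ t p D mk : ℕ) : ℤ) = ((Rᵣ : ℕ) : ℤ) := rfl
  rw [hRR] at hR0
  -- `pitchY ≥ 20K·sL − 1`
  have h20 : 20 * Kᵣ * (((Uᵣ : ℕ) : ℤ) * sLᵣ) ≤ 20 * Kᵣ * Δᵣ := mul_le_mul_of_nonneg_left hUs hK0
  have hpy : ((Uᵣ : ℕ) : ℤ) * (20 * Kᵣ * sLᵣ - 1) < ((Uᵣ : ℕ) : ℤ) * pitchY κ Φ t p D g f := by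
    have e : ((Uᵣ : ℕ) : ℤ) * (20 * Kᵣ * sLᵣ - 1) = 20 * Kᵣ * (((Uᵣ : ℕ) : ℤ) * sLᵣ) - ((Uᵣ : ℕ) : ℤ) := by ring
    linarith
  have hpy' := lt_of_mul_lt_mul_left hpy hU.le
  have hKs : 40 * sLᵣ ≤ Kᵣ * sLᵣ := mul_le_mul_of_nonneg_right hK40 (by linarith)
  unfold Skelφ.kgFarY
  rw [kgSLY_eq_kgSL]
  push_cast
  linarith

/-- **THE CENTRING AT THE TUPLE**: `FarY N ≤ tgtY0 < FarY N + sL + (3R′ + 2)` at `N := kgNYv0` (`kgNY_spec`). [this work] -/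
theorem farY_spec_W (hKq : 5 ≤ Neg.Kq κ) (hN : EqNumL κ Φ t p D g f) (hg : gFloorKG κ Φ t p D mk ≤ g) (hg2 : 40 * Neg.K κ * KS0.R'0 κ Φ t p D mk ≤ g) :
    (((NYᵣ : ℕ) : ℤ) + 1) * sLᵣ + kgXY nᵣ ℓᵣ hᵣ vᵣ Rᵣ 0 qYᵣ WYᵣ NYᵣ ≤ kgTgtY0 κ Φ t p D g f mk ∧ kgTgtY0 κ Φ t p D g f mk < (((NYᵣ : ℕ) : ℤ) + 1) * sLᵣ + kgXY nᵣ ℓᵣ hᵣ vᵣ Rᵣ 0 qYᵣ WYᵣ NYᵣ + sLᵣ + (3 * ((Rᵣ : ℕ) : ℤ) + 2) := by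
  have H := kgYRows0_of κ Φ t p D g f mk (qxYQ4 κ Φ t p D g f) (WxYQ4 κ Φ t p D g f) hN hg
  have hspec := H.kgNY_spec (farY_zero_le_tgtY0_W κ Φ t p D g f mk hKq hN hg hg2)
  have hNv : kgNY nᵣ ℓᵣ hᵣ vᵣ Rᵣ 0 qYᵣ WYᵣ (kgTgtY0 κ Φ t p D g f mk) = NYᵣ := rfl
  rw [hNv] at hspec
  have eΔ : kgΔY Rᵣ 0 = 3 * ((Rᵣ : ℕ) : ℤ) + 2 * ((0 : ℕ) : ℤ) + 2 := rfl
  unfold Skelφ.kgFarY at hspec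
  rw [eΔ, kgSLY_eq_kgSL] at hspec
  push_cast at hspec
  exact ⟨by linarith [hspec.1], by linarith [hspec.2]⟩

/-- **THE y′-ARRIVAL READING ROW, ALONG (`hLl` at `du.1 = 1`)**: `20r₁ − b₁ + 1 ≤ rdLo₁ ∧ 5r₁ ≤ rdLo₁ ∧ rdHi₁ ≤ 20r₁ + b₁ − 1 ∧ rdHi₁ ≤ 22r₁` for the box
`[arrLoY3, arrHiY3]` and the window of record `b₁ = BSlot.small3 1 = 19·s₁`. [this work] -/
theorem hLlY_W (hKq : 5 ≤ Neg.Kq κ) (hN : EqNumL κ Φ t p D g f) (hg : gFloorKG κ Φ t p D mk ≤ g) (hg2 : 40 * Neg.K κ * KS0.R'0 κ Φ t p D mk ≤ g) :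
    20 * r1ᵣ - ((BSlot.small3 κ Φ t p D g f 1 : ℕ) : ℤ) + 1 ≤ LO1ᵣ ∧ 5 * r1ᵣ ≤ LO1ᵣ ∧ HI1ᵣ ≤ 20 * r1ᵣ + ((BSlot.small3 κ Φ t p D g f 1 : ℕ) : ℤ) - 1 ∧ HI1ᵣ ≤ 22 * r1ᵣ := by
  obtain ⟨-, hsc1, hn1, -, hDp, hm, -, -, hkq, -⟩ := hsc_Q κ Φ t p D g f hN
  obtain ⟨-, hs40, hbig, hR1, hK40, -⟩ := valsQ_floor κ Φ t p D g f mk hN hg hg2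
  have hUs := UsL_le_modulus κ Φ t p D g f hN
  obtain ⟨hpy1, hpy2⟩ := pitchY_floor_W κ Φ t p D g f hN
  obtain ⟨ht1, ht2⟩ := tgtY0_two_mul_W κ Φ t p D g f mk
  obtain ⟨hfar, htgt⟩ := farY_spec_W κ Φ t p D g f mk hKq hN hg hg2
  have hP1 := Skelφ.natDiv_le_kgSLY hn1 ℓᵣ hᵣ
  rw [kgSLY_eq_kgSL] at hP1
  have hP0nat : ((nᵣ * ℓᵣ / Uᵣ : ℕ) : ℤ) = ((nᵣ : ℕ) : ℤ) * ℓᵣ / (Uᵣ : ℕ) := by push_cast; rfl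
  have hRR : ((KS0.R'0 κ Φ t p D mk : ℕ) : ℤ) = ((Rᵣ : ℕ) : ℤ) := rfl
  rw [hRR] at hs40 hR1
  have hU : (0 : ℤ) < (Uᵣ : ℕ) := Skelφ.shearUnit_pos hn1 _
  have hU1 : (1 : ℤ) ≤ (Uᵣ : ℕ) := by linarith
  have hs1one : (1 : ℤ) ≤ s1ᵣ := by exact_mod_cast (fcellsA κ Φ t p D g f).hs 1
  -- the box rows
  obtain ⟨-, -, elo1, ehi1⟩ := arrY3_apply κ Φ t p D g f mk
  rw [kgSLY_eq_kgSL] at elo1 ehi1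
  have hlo : arrLoY3 κ Φ t p D g f mk 1 = arrHiY3 κ Φ t p D g f mk 1 - ((nᵣ * ℓᵣ / Uᵣ : ℕ) : ℤ) := by rw [elo1, ehi1, hP0nat]; push_cast; ring
  rw [← ehi1] at hfar htgt
  -- the fine-1 reading is `⌊s₁·X/Δ⌋`
  have hr1 : r1ᵣ = 40 * ((Neg.Kq κ : ℕ) : ℤ) * s1ᵣ := by
    rw [PCells2.r_eq, show ((fcellsA κ Φ t p D g f).K : ℤ) = Neg.K κ by exact_mod_cast (fcellsA_K κ Φ t p D g f).1,
      show (Neg.K κ : ℤ) = 40 * ((Neg.Kq κ : ℕ) : ℤ) by exact_mod_cast Neg.K_eq κ]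
  have hr1K : r1ᵣ = Kᵣ * s1ᵣ := by rw [PCells2.r_eq, show ((fcellsA κ Φ t p D g f).K : ℤ) = Neg.K κ by exact_mod_cast (fcellsA_K κ Φ t p D g f).1]
  have hb1 : ((BSlot.small3 κ Φ t p D g f 1 : ℕ) : ℤ) = 19 * s1ᵣ := by rw [(small3_eq κ Φ t p D g f).2]; push_cast; ring
  have hkq' : (0 : ℤ) < ((Neg.Kq κ : ℕ) : ℤ) := by exact_mod_cast hkq
  have hsc1' : (prFA κ Φ t p D g f).c₁ * Aof κ * (40 * ((Neg.Kq κ : ℕ) : ℤ) * Δᵣ) = 40 * ((Neg.Kq κ : ℕ) : ℤ) * s1ᵣ * (prFA κ Φ t p D g f).D := by rw [hsc1, hr1]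
  rw [Skelφ.rdLo_one, Skelφ.rdHi_one, rd1_div_eq (X := _) hDp hkq' hm hsc1', rd1_div_eq (X := _) hDp hkq' hm hsc1', hr1K, hb1]
  have hFlo' := Int.lt_mul_ediv_self_add (x := s1ᵣ * (((Uᵣ : ℕ) : ℤ) * arrLoY3 κ Φ t p D g f mk 1)) hm
  have hFhi := Int.mul_ediv_self_le (x := s1ᵣ * (((Uᵣ : ℕ) : ℤ) * arrHiY3 κ Φ t p D g f mk 1 + ((Uᵣ : ℕ) : ℤ) - 1)) (ne_of_gt hm)
  exact arrivalY_coreW (hU := hU1) (hUs := hUs) (hs := hbig) (hK := hK40) (hR := hR1) (hKR := hs40) (hP1 := hP1) (hpy1 := hpy1) (hpy2 := hpy2)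
    (ht1 := ht1) (ht2 := ht2) (hfar := hfar) (htgt := htgt) (hlo := hlo) (hs1 := hs1one) (hFlo' := hFlo') (hFhi := hFhi)

end ArrivalY

end NegB

end PlanarSkeletonFrm

end Summit.CriticalPhenomena.PercolationContinuityZ3.Theorems.Transplant

end
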